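import Literature.Analysis.FluidPDE.SereginSverakAxisymmetric
import HarnessLib

/-!
# Seregin 2022: local regularity of axisymmetric suitable weak solutions under the
# logarithmic swirl bound `|σ| ≤ C₁ / ln³(e/ϱ)` (the engine of JMFM 24 (2022), Thm. 1.2)

Topic `Literature/Analysis/FluidPDE`; one named fact (a result in print that the tree has not
proved, `def … : Prop`, CONVENTIONS §4), requested by the line `registered` of the crux
`Summit.NavierStokesRegularity.NavierStokesRegularity.Theses.AxisymmetricExtremality.AxisymmetricKatoGlobal`
(item `stmt-NavierStokesRegularity-15453`), whose stub `stub_sereginLogSwirlOrigin` is this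
statement verbatim.

## What is printed

G. Seregin, *A note on local regularity of axisymmetric solutions to the Navier–Stokes
equations*, J. Math. Fluid Mech. 24 (2022), Paper No. 27 = arXiv:2201.00153 (references below to
the arXiv version).

* **Setting (§1).** `Q = 𝒞 × ]-1, 0[`, `𝒞 = {x : x₁² + x₂² < 1, -1 < x₃ < 1}` the unit cylinder of
  `ℝ³`; `Q(R) = 𝒞(R) × ]-R², 0[`.  **Def. 1.1** (suitable weak solution in `Q_* = ω × ]T₁, T₂[`):
  (1) `w ∈ L_{2,∞}(Q_*)`, `∇w ∈ L₂(Q_*)`, `r ∈ L_{3/2}(Q_*)`; (2) `w`, `r` satisfy the Navier–Stokes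
  equations `∂ₜv + v·∇v - Δv = -∇q`, `div v = 0` (`ν = 1`, no force) in the sense of
  distributions; (3) for a.a. `t ∈ [T₁, T₂]` the local energy inequality
  `∫_ω φ|w|²(t) + 2∫_{T₁}^t∫_ω φ|∇w|² ≤ ∫_{T₁}^t∫_ω (|w|²(∂ₜφ + Δφ) + w·∇φ(|w|² + 2r))` for all
  nonnegative `φ ∈ C¹₀(ω × ]T₁, T₂ + (T₂ - T₁)/2[)`.  **Standing assumption:** `v` and `q` are
  axially symmetric about the `x₃`-axis (`v_{r,θ} = v_{θ,θ} = v_{3,θ} = q_{,θ} = 0`).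
* **Thm. 1.2.** An axially symmetric suitable weak solution `(v, q)` in `Q` satisfying the
  slightly supercritical condition (1.2)–(1.3) — `f(R) + M(R) ≤ c_* ln^α ln^{1/2}(1/R)` for
  `0 < R ≤ 2/3`, `0 < α ≤ 1/224`, `f`, `M` scaled `L_{3,4}` / `L_{10/3}` norms of
  `v̄ = v_r e_r + v₃ e₃` on `Q(R)` — has the origin `z = 0` as a regular point.
* **Prop. 1.3** (proved in Seregin 2021): under the hypotheses of Thm. 1.2 the swirl
  `σ = ϱ v_φ = v₂x₁ - v₁x₂` has the modulus of continuity (1.5) at the origin.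
* **§2, proof of Thm. 1.2, Steps 1–4.**  Step 1 fixes a cut-off `η = φ(r)ψ(x₃)ξ(t)` adapted to the
  partial regularity of `v` (singular points lie on the axis and have `𝒫¹`-measure zero, so there
  are regular axis points `(0, ±h, 0)` and a singularity-free slab `𝒞(r₀) × [t₀, t₀ + δ₀²]`) and
  records that (1.2)–(1.3) enter ONLY through Prop. 1.3, in the form (2.1)
  `|σ| ≤ C₁ e^{-c ln^{1/4}(1/r)}`, which implies
  **(2.2) `|σ(r, x₃, t)| = r|v_θ| ≤ cC₁ / ln³(e/r)` in `𝒞`.**  Everything after runs from (2.2)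
  alone: Step 2 = Lemma 2.1 (elliptic estimates for `η³v_r/r` through the system `div v̄ = 0`,
  `curl v̄ = ω_θ e_θ`, the Newton potential, Prop. 2.9 of Hmidi–Rousset 2011 and the global bounds
  of Chen–Fang–Zhang 2017); Step 3 = localised energy estimates for `Φ = ω_r/r` and `Γ = ω_θ/r`
  (their equations with drift `v - 2x'/|x'|²`, the boundary terms `π∫(η³Φ)²|_{x'=0}`, the 2D Leray
  inequality Lemma 2.2 `∫_𝒞 |f|²/(|x'|² ln²(e/|x'|)) ≤ 4∫_𝒞 |∇_{x'}f|²`, and the smallness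
  `cC₁/ln(e/r₁) + cC₁²/ln⁴(e/r₁) < 2` bought from (2.2) by shrinking `r₁`), giving
  `sup_t ∫ η⁶(|Γ|² + |Φ|²) + ∫∫ η⁶(|∇Φ|² + |∇Γ|²) ≤ C(v, η, r₁)`; Step 4 = `C(R) = R⁻²∫_{Q(R)}|v|³ → 0`
  (elliptic theory for `η³v̄`, the `L_{10/3}` bound of `v_θ` through `Φ`), whence "according to the
  partial regularity theory for the Navier–Stokes equations … the origin `z = 0` is a regular point
  of `v`" (the Caffarelli–Kohn–Nirenberg `ε`-regularity criterion).

## What is stated here, and why in the (2.2)-form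

`seregin2022_logSwirl_regularAtOrigin` is the statement that §2 actually proves: **Def. 1.1 in
`Q` + axial symmetry of `v` and `q` + the swirl bound (2.2) in `Q` ⇒ the origin is a regular point
of `v`** (`v ∈ L_∞(Q(r))` for some `r > 0`).  This is the form the crux line consumes (a
logarithmic modulus of the swirl AT THE AXIS is the hypothesis its other stubs produce and
transfer), it is the common engine of Thm. 1.2 and of the Pan-type Thm. 1.4, and it does not drag
in the quantities `f`, `M` of (1.2).  The printed Thm. 1.2 is this statement composed with
Prop. 1.3 ((1.2)–(1.3) ⇒ (2.1) ⇒ (2.2)), which is not restated here.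

## Rendering (all vocabulary accepted; nothing new is defined)

Physical space `ℝ³ = EuclideanSpace ℝ (Fin 3)`, space–time `ℝ × ℝ³` written time first.
`Q = SereginSverak2009.parCyl 0 1` / `parCylOpens 0 1`, `𝒞 = SereginSverak2009.spaceCyl 0 1`
(`SereginSverakAxisymmetric.lean`; literally Seregin's `𝒞 × ]-1, 0[`).  Def. 1.1 is rendered
exactly as Def. 1.3 of Seregin 2020 is rendered in the accepted
`Seregin2020_axisymmetricSingularPoint_typeII` (`Seregin2020AxisymmetricTypeII.lean`) and as the
hypotheses of the proved `Seregin2020.offAxis_regular` (`Seregin2020SingularSetAxis.lean`): the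
accepted LOCAL notion `IsSuitableWeakSolutionOn (parCylOpens 0 1) 1 0 v q` (distributional
solution, local classes, local energy inequality against nonnegative `C_c^∞(Q)` cut-offs; CKN 1982 /
Lin 1998) PLUS the printed GLOBAL classes of Def. 1.1 (1) on `Q`: `esssup_{-1<t<0} ∫_𝒞 |v(t)|² < ∞`,
a weak spatial gradient `G = ∇v` on `Q` with `∫∫_Q |G|² < ∞`, `∫∫_Q |q|^{3/2} < ∞`.  (Def. 1.1 (3)
allows `C¹₀` cut-offs not vanishing at the top time and is sliced in time; for a.a. `t < 0` only
the cut-off below `t` enters, and the sliced form follows from the integrated one given the global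
classes — in tree: `IsSuitableWeakSolutionOn.ae_localEnergy_slice_of_forall_lt`,
`SuitableWeakSliced.lean`; cf. the docstring of `IsSuitableWeakSolutionInBall`, `LocalTypeI.lean`.)
Axial symmetry is imposed POINTWISE on every slice `v t`, `q t`, `-1 < t < 0` (`IsAxisymmetric`,
`IsAxisymmetricScalar`, axis `x₃ = x 2`; `AxisymmetricEuler.lean`) — stronger than the symmetry of
the `L_{2,∞}`/`L_{3/2}` classes, hence harmless as a hypothesis.  The swirl is the accepted
`swirl (v t) x = x 0 * v t x 1 - x 1 * v t x 0 = σ` (same sign as the printed `v₂x₁ - v₁x₂`), and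
(2.2) is imposed for every `t ∈ ]-1, 0[` at every `x ∈ 𝒞` OFF the axis, `0 < cylRadius x = |x'| < 1`
(so `ln(e/|x'|) > 1`), as `|σ| ≤ C₁ / (log (e/|x'|))³`; on the axis `σ = 0`
(`swirl_eq_zero_of_cylRadius_eq_zero`) and the guard is cosmetic
(`seregin2022_logSwirl_regularAtOrigin.swirlBound_iff`).  Imposing (2.2) pointwise for the given
representative on all of `Q` (the proof uses it on `{|x'| < r₁} ∩ supp η` for the continuous
representative) is again the stronger hypothesis.  The conclusion is the accepted
`SereginSverak2009.IsRegularAtOrigin v` ("`v` essentially bounded in `Q(r)` for some `r > 0`",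
Seregin–Šverák 2009, §3), which is what the `ε`-regularity criterion invoked in Step 4 delivers
(Hölder continuity on a closed sub-cylinder, in particular boundedness).  Viscosity `1`, no force,
as printed.  Nothing is asserted: users take `(h : seregin2022_logSwirl_regularAtOrigin)`.

## What a discharge needs (inventory, 2026-08-17)

In tree (proved): CKN partial regularity `ckn_partial_regularity_holds` (`PartialRegularityHolds.lean`)
and its axisymmetric corollaries `SereginSverak2009.isRegularPoint_of_cylRadius_ne_zero_parCyl`,
`singularSet_subset_axis` (`AxisymmetricSingularSetOnAxis.lean`), `Seregin2020.offAxis_regular`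
(`Seregin2020SingularSetAxis.lean`, same hypotheses as here); the `ε`-regularity criteria
`ckn_epsilon_regularity_holds` (CKN Prop. 2), `seregin2014_thm14_holds` (Seregin 2014, Ch. 6
Thm. 1.4); higher regularity at regular points `NSBoundedHigherRegularity_holds`
(`KNSSNoAxisymmetricTypeIHolds.lean`) — Step 1's "`v`, `∇v`, `∇²v` bounded on `supp ∇η`"; the
radial core of Lemma 2.2, `Literature.Analysis.Calculus.hardy_log_core` (`HardyLogarithmic.lean`)
and `logHardy` (`LeiZhang2017LogHardy.lean`); Calderón–Zygmund for the Newton potential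
`exists_eLpNorm_hessian_newtonPotential_le` (`CalderonSplittingLp.lean`); the equations of
`Γ = ω_θ/r` and `Φ = ω_r/r` for CLASSICAL axisymmetric solutions,
`IsClassicalNSSolutionOn.angVortQuot_eq` / `.radVelQuot_curl_eq` (`AxisymQuotientEquationsOmega/J.lean`).
NOT in tree: Lemma 2.1 (the localised div–curl estimates for `η³v_r/r`, Hmidi–Rousset's identity,
the `W`-bounds of Chen–Fang–Zhang 2017), the Step 3 localised energy scheme for suitable weak
solutions (run between singular times, with the boundary terms at the axis), and the Step 4
passage `|η³Φ|_{2,Q} + |η³Γ|_{2,Q} < ∞ ⇒ C(R) → 0`.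

## Mathlib / tree search

Mathlib has no Navier–Stokes theory.  `lean search 'Seregin2022|2201.00153|logSwirl'`: only the
crux line's docstrings; nearest accepted statements are the GLOBAL classical criteria
`LeiZhang2017_logModulus_regularity` (`|Γ| ≤ C₁/ln² r`) and `Wei2016_logModulus_regularity`
(`|Γ| ≤ |ln r|^{-3/2}`) of `LeiZhang2017AxisymmetricCriteria.lean` (finite-energy classical
solutions from decaying data, conclusion = continuation), of which the present fact is the LOCAL
suitable-weak version with the weaker modulus `ln⁻³`.

## References

* G. Seregin, J. Math. Fluid Mech. 24 (2022), Paper No. 27 = arXiv:2201.00153: Def. 1.1, Thm. 1.2,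
  Prop. 1.3, §2 Steps 1–4 ((2.1), (2.2), Lemma 2.1, Lemma 2.2, (2.7), (2.8)).
  [`Seregin2022LocalAxisym`]
* G. Seregin, V. Šverák, Comm. PDE 34 (2009) = arXiv:0804.1803, §3 p. 9 (cylinders, regular
  points). [`SereginSverak2009`]
* G. Seregin, Anal. Math. Phys. 10 (2020), Paper 46, Def. 1.3 (the same class). [`Seregin2020`]
* L. Caffarelli, R. Kohn, L. Nirenberg, CPAM 35 (1982); F. Lin, CPAM 51 (1998), Def. 1.
  [`CaffarelliKohnNirenberg1982`, `Lin1998`]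
-/

noncomputable section

open MeasureTheory Set Function Filter Topology TopologicalSpace Metric
open scoped NNReal ENNReal

namespace Literature.Analysis.FluidPDE

/-- Local notation for physical space `ℝ³ = EuclideanSpace ℝ (Fin 3)`. -/
local notation "ℝ³" => EuclideanSpace ℝ (Fin 3)

/-! ### The named fact -/

/-- **Seregin 2022, §2 (proof of Thm. 1.2, Steps 1–4, run from the swirl bound (2.2)): local
regularity of axisymmetric suitable weak solutions with logarithmically small swirl at the axis.**
Let `(v, q)` be a suitable weak solution of the Navier–Stokes equations (`ν = 1`, no force) in the
unit cylinder `Q = 𝒞 × ]-1, 0[` in the sense of Def. 1.1 — the accepted local notion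
`IsSuitableWeakSolutionOn` on `Q` together with the global classes `v ∈ L_{2,∞}(Q)`,
`∇v = G ∈ L₂(Q)` (a weak spatial gradient on `Q`), `q ∈ L_{3/2}(Q)` —, axially symmetric (every
slice `v t`, `q t`, `-1 < t < 0`), whose swirl `σ = ϱ v_φ = x₁v₂ - x₂v₁` obeys
(2.2) `|σ(x, t)| ≤ C₁ / ln³(e/|x'|)` for `-1 < t < 0` and `x ∈ 𝒞` off the axis.  Then "the origin
`z = 0` is a regular point of `v`": `v ∈ L_∞(Q(r))` for some `r > 0`
(`SereginSverak2009.IsRegularAtOrigin`).  The printed Thm. 1.2 assumes instead the slightly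
supercritical condition (1.2)–(1.3), used only to obtain (2.2) through Prop. 1.3 (Step 1); Steps
2–4 prove exactly the present implication (module docstring: rendering, discharge inventory).
[cite: Seregin2022LocalAxisym, §2 proof of Thm. 1.2, Steps 1–4 from (2.2) (arXiv:2201.00153 pp. 4–7); Def. 1.1; Thm. 1.2] -/
def seregin2022_logSwirl_regularAtOrigin : Prop :=
  ∀ (v : ℝ → ℝ³ → ℝ³) (q : ℝ → ℝ³ → ℝ),
    IsSuitableWeakSolutionOn (SereginSverak2009.parCylOpens 0 1) 1 0 v q →
    (∃ C : ℝ≥0, ∀ᵐ t ∂(volume.restrict (Ioo (-1 : ℝ) 0)),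
        ∫⁻ x in SereginSverak2009.spaceCyl 0 1, ‖v t x‖ₑ ^ 2 ≤ C) →
    (∃ G : ℝ → ℝ³ → ℝ³ →L[ℝ] ℝ³,
        HasWeakSpatialGradientOn (SereginSverak2009.parCylOpens 0 1) v G ∧
        ∫⁻ z in SereginSverak2009.parCyl 0 1, ENNReal.ofReal (frobeniusNormSq (G z.1 z.2)) < ∞) →
    (∫⁻ z in SereginSverak2009.parCyl 0 1, ‖q z.1 z.2‖ₑ ^ (3 / 2 : ℝ) < ∞) →
    (∀ t ∈ Ioo (-1 : ℝ) 0, IsAxisymmetric (v t)) →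
    (∀ t ∈ Ioo (-1 : ℝ) 0, IsAxisymmetricScalar (q t)) →
    (∃ C₁ : ℝ, ∀ t ∈ Ioo (-1 : ℝ) 0, ∀ x ∈ SereginSverak2009.spaceCyl 0 1, 0 < cylRadius x →
        |swirl (v t) x| ≤ C₁ / Real.log (Real.exp 1 / cylRadius x) ^ 3) →
    SereginSverak2009.IsRegularAtOrigin v

/-! ### API -/

namespace seregin2022_logSwirl_regularAtOrigin

variable {v : ℝ → ℝ³ → ℝ³} {q : ℝ → ℝ³ → ℝ} {G : ℝ → ℝ³ → ℝ³ →L[ℝ] ℝ³}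

/-- The off-axis guard in (2.2) is cosmetic: at a point of the axis the swirl vanishes
(`swirl_eq_zero_of_cylRadius_eq_zero`) and the right-hand side `C₁ / (log (e/0))³` is the junk
value `C₁ / (log 0)³ = 0`, so the bound `|σ| ≤ C₁ / ln³(e/|x'|)` holds on the axis for free; hence
the guarded hypothesis of the fact is equivalent to the unguarded one. [folklore] -/
theorem swirlBound_iff (u : ℝ³ → ℝ³) (C₁ : ℝ) (S : Set ℝ³) :
    (∀ x ∈ S, 0 < cylRadius x → |swirl u x| ≤ C₁ / Real.log (Real.exp 1 / cylRadius x) ^ 3) ↔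
      ∀ x ∈ S, |swirl u x| ≤ C₁ / Real.log (Real.exp 1 / cylRadius x) ^ 3 := by
  refine ⟨fun h x hx => ?_, fun h x hx _ => h x hx⟩
  rcases (cylRadius_nonneg x).eq_or_lt with h0 | hpos
  · rw [swirl_eq_zero_of_cylRadius_eq_zero u h0.symm, ← h0]
    simp
  · exact h x hx hpos

/-- The fact applied, with the weak gradient unbundled (the format of
`Seregin2020_axisymmetricSingularPoint_typeII` and of `Seregin2020.offAxis_regular`): under
Def. 1.1 in `Q`, axial symmetry and (2.2) off the axis, the origin is regular.
[cite: Seregin2022LocalAxisym, §2 proof of Thm. 1.2, Steps 1–4] -/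
theorem isRegularAtOrigin (h : seregin2022_logSwirl_regularAtOrigin)
    (hsw : IsSuitableWeakSolutionOn (SereginSverak2009.parCylOpens 0 1) 1 0 v q)
    (hA : ∃ C : ℝ≥0, ∀ᵐ t ∂(volume.restrict (Ioo (-1 : ℝ) 0)),
      ∫⁻ x in SereginSverak2009.spaceCyl 0 1, ‖v t x‖ₑ ^ 2 ≤ C)
    (hG : HasWeakSpatialGradientOn (SereginSverak2009.parCylOpens 0 1) v G)
    (hE : ∫⁻ z in SereginSverak2009.parCyl 0 1, ENNReal.ofReal (frobeniusNormSq (G z.1 z.2)) < ∞)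
    (hp : ∫⁻ z in SereginSverak2009.parCyl 0 1, ‖q z.1 z.2‖ₑ ^ (3 / 2 : ℝ) < ∞)
    (hv_ax : ∀ t ∈ Ioo (-1 : ℝ) 0, IsAxisymmetric (v t))
    (hq_ax : ∀ t ∈ Ioo (-1 : ℝ) 0, IsAxisymmetricScalar (q t))
    {C₁ : ℝ} (hσ : ∀ t ∈ Ioo (-1 : ℝ) 0, ∀ x ∈ SereginSverak2009.spaceCyl 0 1, 0 < cylRadius x →
      |swirl (v t) x| ≤ C₁ / Real.log (Real.exp 1 / cylRadius x) ^ 3) :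
    SereginSverak2009.IsRegularAtOrigin v :=
  h v q hsw hA ⟨G, hG, hE⟩ hp hv_ax hq_ax ⟨C₁, hσ⟩

/-- The same with the swirl bound imposed at every point of `𝒞`, axis included (equivalent by
`swirlBound_iff`). [cite: Seregin2022LocalAxisym, §2 proof of Thm. 1.2, (2.2)] -/
theorem isRegularAtOrigin_of_forall (h : seregin2022_logSwirl_regularAtOrigin)
    (hsw : IsSuitableWeakSolutionOn (SereginSverak2009.parCylOpens 0 1) 1 0 v q)
    (hA : ∃ C : ℝ≥0, ∀ᵐ t ∂(volume.restrict (Ioo (-1 : ℝ) 0)),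
      ∫⁻ x in SereginSverak2009.spaceCyl 0 1, ‖v t x‖ₑ ^ 2 ≤ C)
    (hG : HasWeakSpatialGradientOn (SereginSverak2009.parCylOpens 0 1) v G)
    (hE : ∫⁻ z in SereginSverak2009.parCyl 0 1, ENNReal.ofReal (frobeniusNormSq (G z.1 z.2)) < ∞)
    (hp : ∫⁻ z in SereginSverak2009.parCyl 0 1, ‖q z.1 z.2‖ₑ ^ (3 / 2 : ℝ) < ∞)
    (hv_ax : ∀ t ∈ Ioo (-1 : ℝ) 0, IsAxisymmetric (v t))
    (hq_ax : ∀ t ∈ Ioo (-1 : ℝ) 0, IsAxisymmetricScalar (q t))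
    {C₁ : ℝ} (hσ : ∀ t ∈ Ioo (-1 : ℝ) 0, ∀ x ∈ SereginSverak2009.spaceCyl 0 1,
      |swirl (v t) x| ≤ C₁ / Real.log (Real.exp 1 / cylRadius x) ^ 3) :
    SereginSverak2009.IsRegularAtOrigin v :=
  isRegularAtOrigin h hsw hA hG hE hp hv_ax hq_ax fun t ht =>
    (swirlBound_iff (v t) C₁ _).2 (hσ t ht)

end seregin2022_logSwirl_regularAtOrigin

end Literature.Analysis.FluidPDE

end
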